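/-
Copyright: b2b-lace packet (LEAN TYPING SEAT 1, gen 21; unit `b2b-lace-lean1-g21`).  N67-S2 part K1 of `LEMMAS.md` §24:
KERNEL-EXACT NON-BACKTRACKING END-POINT COUNTS `b_n(x)` on `ℤ^d` — the coefficient polynomials `P_n` of
[MS93] Cor. 5.3.2 (5.3.3) / [NoBLE17-I] §1.2.2 (1.21) as computable integer lists, the identity
`b_n(x) = Σ_j [P_n]_j · c_j(x)` with the simple-random-walk end-point counts `c_j(x)`, and a ROW FORM that
`decide +kernel` evaluates in polynomial time; it discharges the walk-count table atoms of the `WBX(M)` licence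
(`LiveEndpointClasses`) by the non-backtracking majorant.  Pure combinatorics; `d`-generic; no numeral of the record,
no dimension fixed, no named fact, no `sorry`.  WHAT-IF / input-certification lane: pointer language only.
-/
import Literature.Probability.FitznerVanDerHofstad2017.NbwTwoStepRecursion
import Literature.Probability.FitznerVanDerHofstad2017.SrwLawKernelCount
import Literature.Probability.FitznerVanDerHofstad2017.LiveEndpointClasses
import Literature.Probability.FitznerVanDerHofstad2017.SrwIntegralSupZero
import HarnessLib

/-!
# Kernel-exact non-backtracking end-point counts (the polynomials `P_n` of (5.3.3) over the SRW counts)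

CITATION HEADER (PLACEMENT v2). This module is part of a certified REPRODUCTION of:
R. Fitzner, R. van der Hofstad, *Mean-field behavior for nearest-neighbor percolation in d > 10*,
Electron. J. Probab. 22 (2017), no. 43, 1–65 [FvdH17], and *Generalized approach to the non-backtracking
lace expansion*, Probab. Theory Related Fields 169 (2017), 1041–1119 [NoBLE17-I] (arXiv:1506.07977, 1506.07969).
Reproduces: the non-backtracking-walk end-point counts `b_n(x)` that majorise the self-avoiding-walk counts
`c_n(x)` in the explicit terms of [NoBLE17-I] §5.3.3 / [FvdH17] §4.2 (4.18) (notebook `Percolation.nb`, the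
`c_i(class)` tables beyond the exactly enumerated orders), as KERNEL-EVALUABLE exact integers.  The published
input is the memory-two generating function of N. Madras, G. Slade, *The Self-Avoiding Walk* (1993) [MS93],
Cor. 5.3.2 (5.3.3) (held reprint, PDF p. 148): `Ĝ_z(k; 2) = (1 − z²) / (1 + (2d−1) z² − 2dz D̂(k))`
(= [NoBLE17-I] §1.2.2 (1.21), `B̂_z(k)`), i.e. `b̂_n(k) = P_n(2dD̂(k))` with
`P_0 = 1`, `P_1 = A`, `P_2 = A² − 2d`, `P_{m+2} = A·P_{m+1} − (2d−1)·P_m` (`m ≥ 1`).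
Origin: build `lace`, node N67-S2 (the table side of the `WBX(M)` cell; coverage census of enumeration shard A,
gen 37), part K1.

## What is here (all `d`-generic, `x`-generic; no numerals outside the closing sanity `example`s)

§1 `nbwPolyComb`, `nbwPolyCoefPair`, **`nbwPolyCoef d n`** — the coefficient list `[P_n]_0, …, [P_n]_n` of `P_n` in powers
   of `A`, by a SINGLE recursion on the pair `(P_{m+1}, P_{m+2})` (each level refers to the previous pair once —
   the kernel-friendly shape of `SrwLawKernelCount`); `length_nbwPolyCoef`, `nbwPolyCoef_add_two`.
§2 `nbwEval c x = Σ_{j < |c|} c_j · c_j(x)` with `c_j(x) = SrwCount.srwCount d j x` (the exact number of `j`-step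
   nearest-neighbour walks `0 → x`); its algebra: `nbwEval [1] x = δ_0(x)` (`srwCount_zero`), the SHIFT
   `nbwEval (0 :: c) x = Σ_{s = ±e_μ} nbwEval c (x − s)` (multiplication by `A = 2dD̂` is one SRW step:
   `srwCount_succ`, from `SrwCount.G_succ_right`), linearity `nbwEval_nbwPolyComb`.
§3 **`card_nbwWordsTo_eq_nbwEval : (#nbwWordsTo d n x : ℤ) = nbwEval (nbwPolyCoef d n) x`** — `b_n(x) = Σ_j [P_n]_j c_j(x)`,
   by induction from the tree's x-space two-step recursion (`NbwTwoStepRecursion.card_nbwWordsTo_zero / _one /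
   _two_step_zero / _two_step`), which is (5.3.3) cleared of its denominator.
§4 ROW FORM for the kernel: `nbwDot`, **`nbwCountRow L A x = [b_0(x), …, b_L(x)]`** read off ONE
   `SrwCount.srwCountRow L A x` (valid for `|x_μ| + L ≤ A`), bridge **`nbwCountRow_getD`**; cost `O(d·L² + L³)`
   big-integer operations per point.
§5 The SAW-table atoms by the NBW majorant: `card_sawWordsTo_le_nbwCountRow_getD` (`c_n(x) ≤ b_n(x)` read off the
   row; `card_sawWordsTo_le_card_nbwWordsTo` of `WeightedBubbleExplicitPieces`), `natAbs_canonSite_le` (row validity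
   at the canonical points `canonSite d l` of `LiveEndpointClasses`), **`nbwAtom d L l r = b_r(canonSite d l)`**
   (`r ≤ L`) with `cast_card_sawWordsTo_canonSite_le_nbwAtom`, `nbwAtom_eq_card`, `nbwAtom_nonneg`, and the three
   binder-shaped discharges `sawAtoms_outer_le_nbwAtom` / `sawAtoms_inner_le_nbwAtom` / `nbwAtom_inner_nonneg` of the
   hypotheses `hC` / `hb` / `hb0` of `toReal_tsum_sq_weighted_repBubble_le_liveListAtomsCanon`; the all-NBW reading
   of that cell, **`toReal_tsum_sq_weighted_repBubble_le_liveListNbwAtoms`** (only the `K_{1,L}` majorants `hK` and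
   the diagrammatic constants are left to the consumer), and its ALL-KERNEL reading
   **`toReal_tsum_sq_weighted_repBubble_le_liveListNbwAtomsUniformK`**: at an even cut `2·J i l` the far-node
   majorant is the `x`-UNIFORM cap `K_{1,2j}(x) ≤ I_{1,2j}(0)` of [NoBLE17-I] (5.14)/(5.26)
   (`SrwIntegralSupZero.srwK_le_srwI_zero_of_even`), so the only simple-random-walk datum left as a hypothesis is an
   upper value of ONE origin integral `I_{1,2J}(0; d)` per cut (the origin `I`-tables of the package).
§6 Sanity evaluations (`decide +kernel`, tiny and table-range sizes; counts, not statements about percolation).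

## What is NOT here
No SAW count (the exact tables `SawCountTables*.lean` are sharper where they exist and can be mixed in atom by
atom by the consumer), no `K_{1,L}` value, no constant of the record, no dimension fixed, no cited hypothesis.
The identification with the Fourier form `b_n(y) = Σ_j [P_n]_j p_j(y) (2d)^j` of `NbwLawFourier`
(`card_nbwWordsTo_eq_sum_coeff_srwP`, real polynomials) is not needed and not imported.

## References
* N. Madras, G. Slade, The Self-Avoiding Walk, Birkhäuser (1993), Thm 5.3.1, Cor. 5.3.2 (5.3.3) (reprint PDF pp. 147–148);
  §1.2 (`c_N ≤ c_{N,2}`: self-avoiding walks are memory-two walks).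
* R. Fitzner, R. van der Hofstad, [NoBLE17-I] §1.2.2 (1.21) (`B̂_z(k)`); §5.3.3 (the explicit terms); [FvdH17] §4.2 (4.18).
-/

namespace Literature.Probability.FitznerVanDerHofstad2017

open _root_.MeasureTheory Finset
open Literature.Barriers.CriticalPhenomena Literature.Probability.Percolation
open Literature.Probability.LatticeModels
open SrwCount (srwCount srwCountRow srwCountRow_getD getD_map_range sum_map_range)
open scoped BigOperators ENNReal

variable {d : ℕ}

/-! ### §1. The coefficient lists of `P_n` -/

/-- `nbwPolyComb c k c'` = the coefficient list of `c − k·c'`, on the index range of `c` (entries of `c'` beyond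
`|c|` are dropped; used only with `|c'| ≤ |c|`).
[cite: MadrasSlade1993, Cor. 5.3.2 (5.3.3) (reprint PDF p. 148): the recursion P_{m+2} = A P_{m+1} - (2d-1) P_m] -/
def nbwPolyComb (c : List ℤ) (k : ℤ) (c' : List ℤ) : List ℤ :=
  (List.range c.length).map fun j => c.getD j 0 - k * c'.getD j 0

/-- The pair of coefficient lists `(P_{m+1}, P_{m+2})`: `(P_1, P_2) = (A, A² − 2d)` and
`(P_{m+2}, P_{m+3}) = (P_{m+2}, A·P_{m+2} − (2d−1)·P_{m+1})` — one reference to the previous pair per level.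
(`2d − 1` is the natural-number subtraction, cast; for `d = 0` both sides of every identity below are degenerate
but true.)
[cite: MadrasSlade1993, Cor. 5.3.2 (5.3.3) (reprint PDF p. 148)]
[cite: FitznerVanDerHofstad2016NoBLE, §1.2.2 (1.21) (arXiv numbering; B̂_z(k) = (1-z²)/(1+(2d-1)z²-2dzD̂(k)))] -/
def nbwPolyCoefPair (d : ℕ) : ℕ → List ℤ × List ℤ
  | 0 => ([0, 1], nbwPolyComb [0, 0, 1] ((2 * d : ℕ) : ℤ) [1])
  | m + 1 =>
      let prev := nbwPolyCoefPair d m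
      (prev.2, nbwPolyComb (0 :: prev.2) ((2 * d - 1 : ℕ) : ℤ) prev.1)

/-- **`nbwPolyCoef d n = ([P_n]_0, …, [P_n]_n)`**, the coefficients of `P_n` in powers of `A = 2dD̂(k)`:
`P_0 = 1`, `P_1 = A`, `P_2 = A² − 2d`, `P_{m+2} = A·P_{m+1} − (2d−1)·P_m` (`m ≥ 1`).
[cite: MadrasSlade1993, Cor. 5.3.2 (5.3.3) (reprint PDF p. 148)]
[cite: FitznerVanDerHofstad2016NoBLE, §1.2.2 (1.21) (arXiv numbering)] -/
def nbwPolyCoef (d : ℕ) : ℕ → List ℤ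
  | 0 => [1]
  | m + 1 => (nbwPolyCoefPair d m).1

/-- The recursion constant: `2d` immediate reversals of a one-step word, `2d − 1` of a longer one.
[cite: MadrasSlade1993, §1.1 p. 3 (2d choices, then 2d-1: c_{N,2} = 2d(2d-1)^{N-1})] -/
def nbwRecK (d : ℕ) : ℕ → ℕ
  | 0 => 2 * d
  | _ + 1 => 2 * d - 1

/-- `|c − k·c'| = |c|` (plumbing). [folklore] -/
private theorem length_nbwPolyComb (c : List ℤ) (k : ℤ) (c' : List ℤ) :
    (nbwPolyComb c k c').length = c.length := by
  simp [nbwPolyComb]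

/-- The defining recursion, all orders in one line: `P_{n+2} = A·P_{n+1} − k_n·P_n`, `k_0 = 2d`, `k_{m+1} = 2d−1`.
[cite: MadrasSlade1993, Cor. 5.3.2 (5.3.3) (reprint PDF p. 148)] -/
theorem nbwPolyCoef_add_two (n : ℕ) :
    nbwPolyCoef d (n + 2) = nbwPolyComb (0 :: nbwPolyCoef d (n + 1)) (nbwRecK d n : ℤ) (nbwPolyCoef d n) := by
  cases n <;> rfl

/-- `P_n` has `n + 1` coefficients. [cite: MadrasSlade1993, Cor. 5.3.2 (5.3.3) (reprint PDF p. 148)] -/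
theorem length_nbwPolyCoef : ∀ n, (nbwPolyCoef d n).length = n + 1
  | 0 => rfl
  | 1 => rfl
  | n + 2 => by
      rw [nbwPolyCoef_add_two, length_nbwPolyComb, List.length_cons, length_nbwPolyCoef (n + 1)]

/-! ### §2. Evaluation against the simple-random-walk counts -/

/-- `nbwEval c x = Σ_{j < |c|} c_j · c_j(x)`, `c_j(x)` = the number of `j`-step nearest-neighbour walks `0 → x`
(`SrwCount.srwCount`): the `x`-space value of the Fourier multiplier `Σ_j c_j (2dD̂(k))^j`.
[cite: MadrasSlade1993, Cor. 5.3.2 (5.3.3) (reprint PDF p. 148)] -/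
def nbwEval (c : List ℤ) (x : Site d) : ℤ :=
  ∑ j ∈ range c.length, c.getD j 0 * (srwCount d j x : ℤ)

/-- `c_0(x) = δ_0(x)`. [cite: FitznerVanDerHofstad2016NoBLE, §5.1.1 (5.4)–(5.5) pp. 1089–1090 (p_0 = δ_0, the SRW n-step law)] -/
theorem srwCount_zero (x : Site d) : srwCount d 0 x = if x = 0 then 1 else 0 := by
  rw [srwCount, SrwCount.G_zero_steps]
  by_cases hx : x = 0
  · rw [if_pos hx, if_pos ((SrwCount.eq_zero_iff_coordD x).1 hx)]
  · rw [if_neg hx, if_neg fun h => hx ((SrwCount.eq_zero_iff_coordD x).2 h)]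

/-- The sum over the `2d` unit steps in the `range d` / `uvec` form of `SrwCount` (re-indexing only). [folklore] -/
private theorem sum_stepVec_sub_eq_sum_range {M : Type*} [AddCommMonoid M] (f : Site d → M) (x : Site d) :
    ∑ s : Fin d × Bool, f (x - stepVec s) =
      ∑ i ∈ range d, (f (x + SrwCount.uvec d i) + f (x - SrwCount.uvec d i)) := by
  rw [Fintype.sum_prod_type,
    ← Fin.sum_univ_eq_sum_range (fun i => f (x + SrwCount.uvec d i) + f (x - SrwCount.uvec d i)) d]
  refine sum_congr rfl fun j _ => ?_
  rw [Fintype.sum_bool, add_comm, SrwCount.uvec_val]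
  simp only [stepVec, if_true, Bool.false_eq_true, if_false, sub_neg_eq_add]

/-- **One SRW step**: `c_{m+1}(x) = Σ_{s = ±e_μ} c_m(x − s)` (the shift identity `SrwCount.G_succ_right` at `j = d`).
[cite: FitznerVanDerHofstad2016NoBLE, §5.1.1 (5.4)–(5.5) pp. 1089–1090 (p_{m+1} = D ⋆ p_m, the SRW n-step law)] -/
theorem srwCount_succ (m : ℕ) (x : Site d) :
    srwCount d (m + 1) x = ∑ s : Fin d × Bool, srwCount d m (x - stepVec s) := by
  rw [sum_stepVec_sub_eq_sum_range]
  exact SrwCount.G_succ_right le_rfl x m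

/-- `nbwEval [1] = δ_0` (`P_0 = 1`). [cite: MadrasSlade1993, Cor. 5.3.2 (5.3.3) (reprint PDF p. 148)] -/
theorem nbwEval_one (x : Site d) : nbwEval [1] x = if x = 0 then 1 else 0 := by
  rw [nbwEval, List.length_singleton, sum_range_one, srwCount_zero]
  split_ifs <;> simp

/-- **The shift**: `nbwEval (0 :: c) x = Σ_{s = ±e_μ} nbwEval c (x − s)` — multiplying the multiplier by
`A = 2dD̂(k)` convolves with one nearest-neighbour step.
[cite: MadrasSlade1993, Cor. 5.3.2 (5.3.3) (reprint PDF p. 148)] -/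
theorem nbwEval_cons_zero (c : List ℤ) (x : Site d) :
    nbwEval (0 :: c) x = ∑ s : Fin d × Bool, nbwEval c (x - stepVec s) := by
  simp only [nbwEval]
  rw [List.length_cons, sum_range_succ', List.getD_cons_zero, zero_mul, add_zero]
  simp_rw [List.getD_cons_succ, srwCount_succ, Nat.cast_sum, mul_sum]
  exact sum_comm

/-- **Linearity**: `nbwEval (c − k·c') = nbwEval c − k · nbwEval c'` for `|c'| ≤ |c|`.
[cite: MadrasSlade1993, Cor. 5.3.2 (5.3.3) (reprint PDF p. 148)] -/
theorem nbwEval_nbwPolyComb (c c' : List ℤ) (k : ℤ) (h : c'.length ≤ c.length) (x : Site d) :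
    nbwEval (nbwPolyComb c k c') x = nbwEval c x - k * nbwEval c' x := by
  simp only [nbwEval]
  rw [length_nbwPolyComb]
  have h1 : ∀ j ∈ range c.length, (nbwPolyComb c k c').getD j 0 = c.getD j 0 - k * c'.getD j 0 :=
    fun j hj => getD_map_range _ (mem_range.1 hj) _
  rw [sum_congr rfl fun j hj => by rw [h1 j hj]]
  have h2 : ∑ j ∈ range c'.length, c'.getD j 0 * (srwCount d j x : ℤ) =
      ∑ j ∈ range c.length, c'.getD j 0 * (srwCount d j x : ℤ) := by
    refine sum_subset (range_subset_range.2 h) fun j _ hj => ?_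
    rw [List.getD_eq_getElem?_getD, List.getElem?_eq_none (by simpa using hj)]
    simp
  rw [h2, mul_sum, ← sum_sub_distrib]
  exact sum_congr rfl fun j _ => by ring

/-! ### §3. `b_n(x) = Σ_j [P_n]_j c_j(x)` -/

/-- The x-space two-step recursion of the tree over `ℤ`, all orders in one line:
`b_{n+2}(x) = Σ_s b_{n+1}(x − s) − k_n · b_n(x)` (a cast of `card_nbwWordsTo_two_step{,_zero}`). [folklore] -/
private theorem cast_card_nbwWordsTo_add_two (n : ℕ) (x : Site d) :
    ((nbwWordsTo d (n + 2) x).card : ℤ) =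
      (∑ s : Fin d × Bool, ((nbwWordsTo d (n + 1) (x - stepVec s)).card : ℤ)) -
        (nbwRecK d n : ℤ) * (nbwWordsTo d n x).card := by
  rw [eq_sub_iff_add_eq]
  cases n with
  | zero => exact_mod_cast card_nbwWordsTo_two_step_zero (d := d) x
  | succ n => exact_mod_cast card_nbwWordsTo_two_step (d := d) n x

/-- **`b_n(x) = Σ_j [P_n]_j · c_j(x)`**: the number of `n`-step non-backtracking walks `0 → x` on `ℤ^d` is the
`P_n`-combination of the simple-random-walk end-point counts — the `x`-space content of
`Ĝ_z(k; 2) = (1 − z²)/(1 + (2d−1)z² − 2dzD̂(k))`, i.e. `b̂_n(k) = P_n(2dD̂(k))`.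
[cite: MadrasSlade1993, Cor. 5.3.2 (5.3.3) (reprint PDF p. 148)]
[cite: FitznerVanDerHofstad2016NoBLE, §1.2.2 (1.21) (arXiv numbering)] -/
theorem card_nbwWordsTo_eq_nbwEval (n : ℕ) (x : Site d) :
    ((nbwWordsTo d n x).card : ℤ) = nbwEval (nbwPolyCoef d n) x := by
  have h0 : ∀ y : Site d, ((nbwWordsTo d 0 y).card : ℤ) = nbwEval (nbwPolyCoef d 0) y := fun y => by
    rw [card_nbwWordsTo_zero, show nbwPolyCoef d 0 = [1] from rfl, nbwEval_one]
    split_ifs <;> simp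
  have h1 : ∀ y : Site d, ((nbwWordsTo d 1 y).card : ℤ) = nbwEval (nbwPolyCoef d 1) y := fun y => by
    rw [card_nbwWordsTo_one, show nbwPolyCoef d 1 = 0 :: [1] from rfl, nbwEval_cons_zero, Nat.cast_sum]
    exact sum_congr rfl fun s _ => h0 _
  have key : ∀ m, (∀ y : Site d, ((nbwWordsTo d m y).card : ℤ) = nbwEval (nbwPolyCoef d m) y) ∧
      (∀ y : Site d, ((nbwWordsTo d (m + 1) y).card : ℤ) = nbwEval (nbwPolyCoef d (m + 1)) y) := by
    intro m
    induction m with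
    | zero => exact ⟨h0, h1⟩
    | succ m ih =>
        refine ⟨ih.2, fun y => ?_⟩
        have hlen : (nbwPolyCoef d m).length ≤ (0 :: nbwPolyCoef d (m + 1)).length := by
          rw [List.length_cons, length_nbwPolyCoef, length_nbwPolyCoef]; omega
        rw [cast_card_nbwWordsTo_add_two, nbwPolyCoef_add_two, nbwEval_nbwPolyComb _ _ _ hlen, nbwEval_cons_zero,
          ih.1 y]
        exact congrArg₂ _ (sum_congr rfl fun s _ => ih.2 _) rfl
  exact (key n).1 x

/-! ### §4. Row form for the kernel -/

/-- `nbwDot c row = Σ_{j < |c|} c_j · row_j` (the row supplies `c_j(x)`). [cite: MadrasSlade1993, Cor. 5.3.2 (5.3.3) (reprint PDF p. 148)] -/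
def nbwDot (c : List ℤ) (row : List ℕ) : ℤ :=
  ((List.range c.length).map fun j => c.getD j 0 * (row.getD j 0 : ℤ)).sum

/-- **Kernel row of the non-backtracking end-point counts** `[b_0(x), …, b_L(x)]`, read off ONE row
`SrwCount.srwCountRow L A x = [c_0(x), …, c_L(x)]` (requires `|x_μ| + L ≤ A` for every coordinate `μ`).
DESIGN NOTE: hand `decide +kernel` THIS (or `nbwAtom`), never a recursive unfolding of `nbwWordsTo`.
[cite: MadrasSlade1993, Cor. 5.3.2 (5.3.3) (reprint PDF p. 148)]
[cite: FitznerVanDerHofstad2016NoBLE, §1.2.2 (1.21) (arXiv numbering)] -/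
def nbwCountRow (L A : ℕ) (x : Site d) : List ℤ :=
  let row := srwCountRow L A x
  (List.range (L + 1)).map fun n => nbwDot (nbwPolyCoef d n) row

/-- **Bridge**: for `n ≤ L` and `|x_μ| + L ≤ A`, entry `n` of `nbwCountRow L A x` is `b_n(x) = #nbwWordsTo d n x`.
[cite: MadrasSlade1993, Cor. 5.3.2 (5.3.3) (reprint PDF p. 148)]
[cite: FitznerVanDerHofstad2016NoBLE, §1.2.2 (1.21) (arXiv numbering)] -/
theorem nbwCountRow_getD {L A n : ℕ} {x : Site d} (hA : ∀ μ : Fin d, (x μ).natAbs + L ≤ A) (hn : n ≤ L) :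
    (nbwCountRow L A x).getD n 0 = ((nbwWordsTo d n x).card : ℤ) := by
  rw [nbwCountRow, getD_map_range _ (by omega) _, nbwDot, sum_map_range, card_nbwWordsTo_eq_nbwEval, nbwEval]
  refine sum_congr rfl fun j hj => ?_
  have hj' : j ≤ n := by have := mem_range.1 hj; rw [length_nbwPolyCoef] at this; omega
  rw [srwCountRow_getD hA (le_trans hj' hn)]

/-! ### §5. The SAW-count table atoms by the NBW majorant -/

/-- **`c_n(x) ≤ b_n(x)`, kernel form**: the number of `n`-step self-avoiding walks `0 → x` is at most entry `n`
of `nbwCountRow L A x` (`n ≤ L`, `|x_μ| + L ≤ A`).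
[cite: MadrasSlade1993, §1.2 (c_N ≤ c_{N,2}: a self-avoiding walk has memory two)]
[cite: FitznerVanDerHofstad2017, §4.2 (4.18)] -/
theorem card_sawWordsTo_le_nbwCountRow_getD {L A n : ℕ} {x : Site d} (hA : ∀ μ : Fin d, (x μ).natAbs + L ≤ A)
    (hn : n ≤ L) : ((sawWordsTo d n x).card : ℤ) ≤ (nbwCountRow L A x).getD n 0 := by
  rw [nbwCountRow_getD hA hn]
  exact_mod_cast card_sawWordsTo_le_card_nbwWordsTo n x

/-- Every entry of `coordList w l` lies in `[w, w + |l|)` (plumbing). [folklore] -/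
private theorem mem_coordList_bounds : ∀ (w : ℕ) (l : List ℕ) (z : ℤ), z ∈ coordList w l →
    (w : ℤ) ≤ z ∧ z < w + l.length
  | w, [], z, h => by simp [coordList] at h
  | w, a :: t, z, h => by
      rw [coordList, List.mem_append, List.mem_replicate] at h
      rcases h with ⟨_, rfl⟩ | h
      · simp
      · have := mem_coordList_bounds (w + 1) t z h
        simp only [List.length_cons, Nat.cast_add, Nat.cast_one] at this ⊢
        omega

/-- The canonical point of a multiplicity list has coordinates of absolute value at most `|l|`
(its non-zero coordinates are `1, …, 1, 2, …, 2, …` with values below `|l| + 1`).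
[cite: FitznerVanDerHofstad2016NoBLE, §5.3.3 p. 1098 (the end-point classes of the explicit terms)] -/
theorem natAbs_canonSite_le (l : List ℕ) (μ : Fin d) : ((canonSite d l) μ).natAbs ≤ l.length := by
  show ((coordList 1 l).getD μ 0).natAbs ≤ l.length
  rw [List.getD_eq_getElem?_getD]
  cases h : (coordList 1 l)[(μ : ℕ)]? with
  | none => simp
  | some z =>
      have hz := mem_coordList_bounds 1 l z (List.mem_of_getElem? h)
      simp only [Option.getD_some, Nat.cast_one] at hz ⊢
      omega

/-- **The NBW table atom** `nbwAtom d L l r = b_r(canonSite d l)` for `r ≤ L` (entry `r` of the kernel row of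
length `L + 1` at the canonical point of the class `l`, with the row validity `A = |l| + L` built in).
[cite: FitznerVanDerHofstad2016NoBLE, §5.3.3 p. 1098 (c_i(class) majorised class by class)]
[cite: MadrasSlade1993, Cor. 5.3.2 (5.3.3) (reprint PDF p. 148)] -/
def nbwAtom (d L : ℕ) (l : List ℕ) (r : ℕ) : ℤ :=
  (nbwCountRow L (l.length + L) (canonSite d l)).getD r 0

/-- `nbwAtom d L l r = b_r(canonSite d l)` for `r ≤ L`.
[cite: MadrasSlade1993, Cor. 5.3.2 (5.3.3) (reprint PDF p. 148)] -/
theorem nbwAtom_eq_card {L r : ℕ} (l : List ℕ) (hr : r ≤ L) :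
    nbwAtom d L l r = ((nbwWordsTo d r (canonSite d l)).card : ℤ) :=
  nbwCountRow_getD (fun μ => Nat.add_le_add_right (natAbs_canonSite_le l μ) L) hr

/-- `0 ≤ nbwAtom d L l r` for `r ≤ L` (it is a count).
[cite: MadrasSlade1993, Cor. 5.3.2 (5.3.3) (reprint PDF p. 148)] -/
theorem nbwAtom_nonneg {L r : ℕ} (l : List ℕ) (hr : r ≤ L) : (0 : ℝ) ≤ (nbwAtom d L l r : ℝ) := by
  rw [nbwAtom_eq_card l hr]
  positivity

/-- **`c_r(canonSite d l) ≤ nbwAtom d L l r`** (`r ≤ L`), over `ℝ` — the shape of one table atom of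
`toReal_tsum_sq_weighted_repBubble_le_liveListAtomsCanon`.
[cite: MadrasSlade1993, §1.2 (c_N ≤ c_{N,2})]
[cite: FitznerVanDerHofstad2017, §4.2 (4.18)] -/
theorem cast_card_sawWordsTo_canonSite_le_nbwAtom {L r : ℕ} (l : List ℕ) (hr : r ≤ L) :
    ((sawWordsTo d r (canonSite d l)).card : ℝ) ≤ (nbwAtom d L l r : ℝ) := by
  rw [nbwAtom_eq_card l hr]
  exact_mod_cast card_sawWordsTo_le_card_nbwWordsTo r (canonSite d l)

/-- Discharge of the OUTER atoms `hC` of `toReal_tsum_sq_weighted_repBubble_le_liveListAtomsCanon` by the NBW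
majorant: `C i l := nbwAtom d i l i = b_i(canonSite d l)`.
[cite: FitznerVanDerHofstad2016NoBLE, §5.3.3 p. 1098; FitznerVanDerHofstad2017, §4.2 (4.18)] -/
theorem sawAtoms_outer_le_nbwAtom (m M : ℕ) :
    ∀ i ∈ Icc m M, ∀ l ∈ liveList d i, ((sawWordsTo d i (canonSite d l)).card : ℝ) ≤ (nbwAtom d i l i : ℝ) :=
  fun _ _ l _ => cast_card_sawWordsTo_canonSite_le_nbwAtom l le_rfl

/-- Discharge of the INNER atoms `hb` of `toReal_tsum_sq_weighted_repBubble_le_liveListAtomsCanon` by the NBW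
majorant: `b i l r := nbwAtom d (L i l) l r = b_r(canonSite d l)` for `r < L i l`.
[cite: FitznerVanDerHofstad2016NoBLE, §5.3.3 p. 1098; FitznerVanDerHofstad2017, §4.2 (4.18)] -/
theorem sawAtoms_inner_le_nbwAtom (m M : ℕ) (L : ℕ → List ℕ → ℕ) :
    ∀ i ∈ Icc m M, ∀ l ∈ liveList d i, ∀ r, r < L i l →
      ((sawWordsTo d r (canonSite d l)).card : ℝ) ≤ (nbwAtom d (L i l) l r : ℝ) :=
  fun _ _ l _ _ hr => cast_card_sawWordsTo_canonSite_le_nbwAtom l hr.le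

/-- Discharge of `hb0` (non-negativity of the inner majorants) for `b i l r := nbwAtom d (L i l) l r`.
[cite: FitznerVanDerHofstad2016NoBLE, §5.3.3 p. 1098] -/
theorem nbwAtom_inner_nonneg (m M : ℕ) (L : ℕ → List ℕ → ℕ) :
    ∀ i ∈ Icc m M, ∀ l ∈ liveList d i, ∀ r, r < L i l → (0 : ℝ) ≤ (nbwAtom d (L i l) l r : ℝ) :=
  fun _ _ l _ _ hr => nbwAtom_nonneg l hr.le

/-- **The `WBX(M)` cell with every walk-count atom read by the NBW majorant** (the all-NBW reading of
`toReal_tsum_sq_weighted_repBubble_le_liveListAtomsCanon`: `C i l := b_i(canonSite d l)`,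
`b i l r := b_r(canonSite d l)`, both as kernel-evaluable `nbwAtom`s; the far-node majorants `K i l ≥ K_{1,L i l}`
and the diagrammatic constants stay hypotheses).  Pointer language: an input-certification form, no statement about
any dimension.
[cite: FitznerVanDerHofstad2016NoBLE, §5.3.1 (5.36)–(5.38) with §5.3.3 p. 1098; FitznerVanDerHofstad2017, §4.2 (4.18)]
[cite: MadrasSlade1993, Cor. 5.3.2 (5.3.3) (reprint PDF p. 148)] -/
theorem toReal_tsum_sq_weighted_repBubble_le_liveListNbwAtoms {ι : Type*} [Fintype ι] [Nonempty ι] (hd : 3 ≤ d) {p : unitInterval}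
    (hp : p ∈ Set.Ioo (nbwThresholdI d) (criticalProbI d)) (m M : ℕ)
    {𝒮 : ι → ℕ × ℕ × Set (Site d)} {cμ : ℝ} {c : ι → ℝ} (hc : ∀ k, 0 < c k) {Γ : Fin 3 → ℝ}
    (hΓ : ∀ i, nobleFOf 𝒮 cμ c i p ≤ Γ i) {k : ι} (hk : 𝒮 k = (1, M + 1, {(0 : Site d)}))
    (L : ℕ → List ℕ → ℕ) {z : ℝ} (hpz : (p : ℝ) ≤ z)
    {K : ℕ → List ℕ → ℝ}
    (hK : ∀ i ∈ Icc m M, ∀ l ∈ liveList d i, srwK d 1 (L i l) (canonSite d l) ≤ K i l) :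
    (∑' y : Site d, ENNReal.ofReal (euclidNorm y ^ 2) *
        bondPercolation (zdGraph d) p (openConnGe m (0 : Site d) y □ openConn y 0)).toReal ≤
      (∑ i ∈ Icc m M, z ^ i *
          ((liveList d i).map fun l =>
            ((2 ^ l.sum * d.descFactorial l.sum / (l.map Nat.factorial).prod : ℕ) : ℝ) *
              ((nbwAtom d i l i : ℝ) * ((sqwsum 1 l : ℝ) *
                ((∑ r ∈ range (L i l), z ^ r * (nbwAtom d (L i l) l r : ℝ)) +
                  (2 * d * z) ^ (L i l) * ((2 * d - 2) / (2 * d - 1) * Γ 1) * K i l)))).sum) +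
        (2 * d * z) ^ (M + 1) * (Γ 2 * c k) :=
  toReal_tsum_sq_weighted_repBubble_le_liveListAtomsCanon hd hp m M hc hΓ hk L hpz
    (C := fun i l => (nbwAtom d i l i : ℝ)) (sawAtoms_outer_le_nbwAtom m M)
    (b := fun i l r => (nbwAtom d (L i l) l r : ℝ)) (sawAtoms_inner_le_nbwAtom m M L)
    (nbwAtom_inner_nonneg m M L) hK

/-- **The `WBX(M)` cell at the ALL-KERNEL reading**: walk-count atoms by the NBW majorant (`nbwAtom`, as in
`toReal_tsum_sq_weighted_repBubble_le_liveListNbwAtoms`) and, at an EVEN cut `L i l = 2 · J i l`, the far-node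
majorants by the `x`-UNIFORM cap `K_{1,2j}(x) ≤ I_{1,2j}(0)` ((5.14) with (5.26); `srwK_le_srwI_zero_of_even`, `d ≥ 3`),
so that the only simple-random-walk data left as hypotheses are upper values `Ibar i l ≥ I_{1,2·J i l}(0; d)` of ONE
origin integral per cut.  Pointer language: an input-certification form, no statement about any dimension.
[cite: FitznerVanDerHofstad2016NoBLE, (5.14) p. 1092; (5.26) p. 1094; §5.3.1 (5.36)–(5.38) with §5.3.3 p. 1098]
[cite: FitznerVanDerHofstad2017, §4.2 (4.18)]
[cite: MadrasSlade1993, Cor. 5.3.2 (5.3.3) (reprint PDF p. 148)] -/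
theorem toReal_tsum_sq_weighted_repBubble_le_liveListNbwAtomsUniformK {ι : Type*} [Fintype ι] [Nonempty ι]
    (hd : 3 ≤ d) {p : unitInterval} (hp : p ∈ Set.Ioo (nbwThresholdI d) (criticalProbI d)) (m M : ℕ)
    {𝒮 : ι → ℕ × ℕ × Set (Site d)} {cμ : ℝ} {c : ι → ℝ} (hc : ∀ k, 0 < c k) {Γ : Fin 3 → ℝ}
    (hΓ : ∀ i, nobleFOf 𝒮 cμ c i p ≤ Γ i) {k : ι} (hk : 𝒮 k = (1, M + 1, {(0 : Site d)}))
    (J : ℕ → List ℕ → ℕ) {z : ℝ} (hpz : (p : ℝ) ≤ z)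
    {Ibar : ℕ → List ℕ → ℝ}
    (hI : ∀ i ∈ Icc m M, ∀ l ∈ liveList d i, srwI d 1 (2 * J i l) 0 ≤ Ibar i l) :
    (∑' y : Site d, ENNReal.ofReal (euclidNorm y ^ 2) *
        bondPercolation (zdGraph d) p (openConnGe m (0 : Site d) y □ openConn y 0)).toReal ≤
      (∑ i ∈ Icc m M, z ^ i *
          ((liveList d i).map fun l =>
            ((2 ^ l.sum * d.descFactorial l.sum / (l.map Nat.factorial).prod : ℕ) : ℝ) *
              ((nbwAtom d i l i : ℝ) * ((sqwsum 1 l : ℝ) *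
                ((∑ r ∈ range (2 * J i l), z ^ r * (nbwAtom d (2 * J i l) l r : ℝ)) +
                  (2 * d * z) ^ (2 * J i l) * ((2 * d - 2) / (2 * d - 1) * Γ 1) * Ibar i l)))).sum) +
        (2 * d * z) ^ (M + 1) * (Γ 2 * c k) :=
  toReal_tsum_sq_weighted_repBubble_le_liveListNbwAtoms hd hp m M hc hΓ hk (fun i l => 2 * J i l) hpz
    (K := Ibar) fun i hi l hl =>
      (srwK_le_srwI_zero_of_even (n := 1) (by omega) (J i l) (canonSite d l)).trans (hI i hi l hl)

/-! ### §6. Sanity evaluations (kernel, `decide +kernel`; counts only — no statement about percolation) -/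

/-- `P_4 = A⁴ − (6d−2)A² + 2d(2d−1)`; at `d = 5`: `[90, 0, −28, 0, 1]`. [folklore] -/
example : nbwPolyCoef 5 4 = [90, 0, -28, 0, 1] := by decide +kernel

/-- `d = 1`: a non-backtracking walk on `ℤ` never turns, `b_n(2) = [n = 2]`. [folklore] -/
example : nbwCountRow 4 6 (![2] : Site 1) = [0, 0, 1, 0, 0] := by decide +kernel

/-- `d = 2`: `b_4(0) = 8` (the unit squares through the origin, two orientations each), `b_2((1,1)) = 2`,
`b_4((1,1)) = 4`, `b_3((2,1)) = 3`, `b_5((2,1)) = 11`. [folklore] -/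
example : nbwCountRow 4 4 (![0, 0] : Site 2) = [1, 0, 0, 0, 8] := by decide +kernel
example : nbwCountRow 4 5 (![1, 1] : Site 2) = [0, 0, 2, 0, 4] := by decide +kernel
example : nbwCountRow 5 7 (![2, 1] : Site 2) = [0, 0, 0, 3, 0, 11] := by decide +kernel

/-- `d = 3`: `b_6(0) = 360`; the atom form at the class `l = [1, 1]` (one coordinate `±1`, one `±2`, canonical
point `(1, 2, 0)`): `b_3 = 3`, `b_5 = 47`. [folklore] -/
example : (nbwCountRow 6 6 (![0, 0, 0] : Site 3)).getD 6 0 = 360 := by decide +kernel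
example : nbwAtom 3 5 [1, 1] 3 = 3 := by decide +kernel
example : nbwAtom 3 5 [1, 1] 5 = 47 := by decide +kernel

/-- Table-range sizes (the whole §6 elaborates in seconds on the farm).  Every value below was CROSS-CHECKED against an
independent enumeration (build `lace`, enumeration shard B's orbit-class dynamic programme `nbw_counts` over
(end point, last step) classes, which agrees with `Σ_j [P_n]_j c_j(x)` on all `7506` / `7759` end-point classes with
`n ≤ 21` in `ℤ¹⁰` / `ℤ¹¹`); they are walk counts (input-certification atoms), not statements about any dimension.
`ℤ¹⁰`: `b_21` at `(1,2,0,…,0)`; `ℤ¹¹`: `b_21(e_1)`; the atom form in `ℤ¹⁰` at the class `l = [3, 1]` (canonical point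
`(1,1,1,2,0,…,0)`): `b_15`, and `b_16 = 0` (parity). [folklore] -/
example : (nbwCountRow 21 24 (![1, 2, 0, 0, 0, 0, 0, 0, 0, 0] : Site 10)).getD 21 0 = 695575272627636324879 := by
  decide +kernel
example : (nbwCountRow 22 23 (![1, 0, 0, 0, 0, 0, 0, 0, 0, 0, 0] : Site 11)).getD 21 0 = 5428268542434537713960 := by
  decide +kernel
example : nbwAtom 10 16 [3, 1] 15 = 30500556836400 := by decide +kernel
example : nbwAtom 10 16 [3, 1] 16 = 0 := by decide +kernel

end Literature.Probability.FitznerVanDerHofstad2017
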